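import Summits.AnomalousDissipation.AnomalousDissipation.Theses.CoherentStates
import Summits.AnomalousDissipation.AnomalousDissipation.Theorems.BaireTransferDenseLoudDesignerForcesStubSweptLaminar
import Summits.AnomalousDissipation.AnomalousDissipation.Theorems.BaireTransferDenseLoudDesignerForcesStubGalileanCovariance
import Literature.Analysis.FunctionSpaces.TorusSpaceTime
import Literature.Analysis.FunctionSpaces.TorusFourierModes
import HarnessLib

/-!
# Route CoherentStates — the support `SteadyBoundedBranch` (stmt-AnomalousDissipation-0221)

Proof of the route declaration
`Summit.AnomalousDissipation.AnomalousDissipation.Theses.CoherentStates.SteadyBoundedBranch`: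
there is a non-zero smooth divergence-free mean-zero steady force `f` on `T³` and, at viscosities
`ν_j → 0`, steady classical Navier–Stokes solutions `(u_j, p_j)` forced by `f` on all of `ℝ × T³`
whose energies `∫ ‖u_j‖²` are bounded uniformly in `j`.

## The witness (Galilean-drift laminar family; TRUE AS TYPED)

The predicate `Torus.IsClassicalNSSolutionOn` does not pin the spatial mean of the velocity, so a
constant drift is admissible.  Take the Kolmogorov-type force `f = Re (e_{e₁} • (-i) e₀) = sin(2πx₁) e₀`
(single real Fourier mode at `k = e₁`, polarised along `e₀ ⊥ k`: smooth, divergence free, mean zero,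
`∫ ‖f‖² = 1/2` so `f ≠ 0`), the drift `V = e₁` and, for `ν > 0`,
`u_ν = V + W_ν`, `W_ν = Re (e_{e₁} • γ_ν e₀)`, `γ_ν = -i / (4π²ν + 2πi)`, `p_ν = 0`.
Shear modes have no self-advection (`(W·∇)W = 0`), the constant `V` is killed by every space
derivative, and `(u·∇)u = DW[V] = Re (e_{e₁} • 2πi γ e₀)`, `Δ W = -4π² W`, so the steady momentum
equation `(u·∇)u = νΔu - ∇0 + f` is the scalar balance `(2πi + 4π²ν) γ = -i`.  The drift detunes the
resonant laminar response `1/(4π²ν)` to `|γ_ν| = 1/|4π²ν + 2πi| ≤ 1/(2π)`, whence the ν-UNIFORM bound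
`‖u_ν(x)‖ ≤ ‖V‖ + |γ_ν| ≤ 2`, `∫ ‖u_ν‖² ≤ 4`; finally `ν_j = 1/(j+1)`.

This is the family recorded in the item's sources / retriage note and in the refuter's evidence
(`Evidence_0221_DriftWitness.md`, `WitnessSteadyBoundedBranch.lean`); the informative variant with
mean-zero velocities is a different (unfiled) statement.  All calculus is the tree's single-mode
toolkit (`TorusFourierModes`, and the landed helper files `…StubSweptLaminar` — `fderiv_mode`,
`convect_mode_eq_zero`, `add_mode`, `smul_realTrigPoly_apply`, `integral_norm_sq_mode`,
`hasZeroMean_mode` — and `…StubGalileanCovariance` — `laplacian_const_add_fun`).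
No definitions are introduced (the lemmas are stated for a general mode amplitude).

References: Frisch, *Turbulence* (1995) §5.2 (Galilean invariance); Doering–Foias, JFM 467 (2002) §2;
Grafakos, *Classical Fourier Analysis* (2014) §3.1.
-/

noncomputable section

namespace Summit.AnomalousDissipation.AnomalousDissipation.Theorems

-- the mandated namespace `Summit.<Summit>.<Problem>.Theorems` repeats `AnomalousDissipation` (single-problem summit)
set_option linter.dupNamespace false

namespace CoherentStatesSteadyDrift

open scoped BigOperators Topology InnerProductSpace Laplacian
open Filter Set Function MeasureTheory UnitAddTorus
open Literature.Analysis.FunctionSpaces Literature.Analysis.FunctionSpaces.Torus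
open Summit.AnomalousDissipation.AnomalousDissipation.Theorems.DenseLoudDesignerForces.Galilean.SweptLaminar
open Summit.AnomalousDissipation.AnomalousDissipation.Theorems.DenseLoudDesignerForces.Galilean.Covariance

/-! ## Single real modes at the frequency `e₁`, polarised along `e₀`

Throughout, the mode with amplitude `g ∈ ℂ` is `Re (e_{e₁} • g e₀) = (Re (g e^{2πi x₁}), 0, 0)`, written
`realTrigPoly {Pi.single 1 1} (fun _ => EuclideanSpace.single 0 g)`; the force is the mode with `g = -i`
(`sin(2πx₁) e₀`), the laminar profile `W_ν` the mode with `g = γ_ν`, and the drift is `V = e₁ =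
EuclideanSpace.single 1 1`. -/

/-- `e₁ ≠ 0` in `ℤ³`. [folklore] -/
theorem kf_ne_zero : (Pi.single 1 1 : Fin 3 → ℤ) ≠ 0 := single_ne_zero one_ne_zero

/-- `|e₁|² = 1`. [folklore] -/
theorem freqNormSq_kf : freqNormSq (Pi.single 1 1 : Fin 3 → ℤ) = 1 := by
  rw [freqNormSq_single]; norm_num

/-- `e₁ · V = 1` for the drift `V = e₁`. [folklore] -/
theorem sum_kf_drift :
    ∑ i, (((Pi.single 1 1 : Fin 3 → ℤ) i : ℤ) : ℂ) * (((EuclideanSpace.single 1 (1 : ℝ) : EuclideanSpace ℝ (Fin 3)) i : ℝ) : ℂ) = 1 := by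
  simp [Pi.single_apply]

/-- The modes `Re (e_{e₁} • g e₀)` are divergence free (`e₁ · g e₀ = 0`). [folklore] -/
theorem isDivFree_mode (g : ℂ) :
    IsDivFree (realTrigPoly {(Pi.single 1 1 : Fin 3 → ℤ)} (fun _ => (EuclideanSpace.single 0 g : EuclideanSpace ℂ (Fin 3)))) :=
  isDivFree_realTrigPoly_singleton (by simp)

/-- The modes `Re (e_{e₁} • g e₀)` have zero mean (non-zero frequency). [folklore] -/
theorem hasZeroMean_mode0 (g : ℂ) :
    HasZeroMean (realTrigPoly {(Pi.single 1 1 : Fin 3 → ℤ)} (fun _ => (EuclideanSpace.single 0 g : EuclideanSpace ℂ (Fin 3)))) :=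
  hasZeroMean_mode kf_ne_zero _

/-- A mode with non-zero amplitude is not the zero field: `∫ ‖Re (e_{e₁} • g e₀)‖² = |g|²/2`. [folklore] -/
theorem mode_ne_zero {g : ℂ} (hg : g ≠ 0) :
    realTrigPoly {(Pi.single 1 1 : Fin 3 → ℤ)} (fun _ => (EuclideanSpace.single 0 g : EuclideanSpace ℂ (Fin 3))) ≠ 0 := by
  intro h
  have h1 : ∫ x, ‖realTrigPoly {(Pi.single 1 1 : Fin 3 → ℤ)} (fun _ => (EuclideanSpace.single 0 g : EuclideanSpace ℂ (Fin 3))) x‖ ^ 2 =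
      ‖(EuclideanSpace.single 0 g : EuclideanSpace ℂ (Fin 3))‖ ^ 2 / 2 :=
    integral_norm_sq_mode kf_ne_zero _
  have h2 : ‖(EuclideanSpace.single 0 g : EuclideanSpace ℂ (Fin 3))‖ = ‖g‖ := by simp
  rw [h, h2] at h1
  have h3 : ‖g‖ ^ 2 / 2 = 0 := by rw [← h1]; simp
  exact hg (by simpa using h3)

/-! ## The steady drifted balance of a mode -/

/-- **The steady drifted Stokes balance** `DW[V] + (W·∇)W = νΔW + f` for the profile `W = Re (e_{e₁} • γ e₀)`,
the drift `V = e₁` and the force `f = Re (e_{e₁} • g e₀)`: shear modes have no self-advection, and on the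
single mode `e₁` it is the scalar identity `2πi γ = -4π²ν γ + g`. [folklore] -/
theorem balance {ν : ℝ} {γ g : ℂ}
    (h : (2 * Real.pi * Complex.I) * γ = ((ν * -(4 * Real.pi ^ 2) : ℝ) : ℂ) * γ + g) (x : UnitAddTorus (Fin 3)) :
    Torus.fderiv (realTrigPoly {(Pi.single 1 1 : Fin 3 → ℤ)} (fun _ => (EuclideanSpace.single 0 γ : EuclideanSpace ℂ (Fin 3)))) x
          (EuclideanSpace.single 1 (1 : ℝ) : EuclideanSpace ℝ (Fin 3)) +
        Torus.convect (realTrigPoly {(Pi.single 1 1 : Fin 3 → ℤ)} (fun _ => (EuclideanSpace.single 0 γ : EuclideanSpace ℂ (Fin 3))))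
          (realTrigPoly {(Pi.single 1 1 : Fin 3 → ℤ)} (fun _ => (EuclideanSpace.single 0 γ : EuclideanSpace ℂ (Fin 3)))) x =
      ν • Torus.laplacian (realTrigPoly {(Pi.single 1 1 : Fin 3 → ℤ)} (fun _ => (EuclideanSpace.single 0 γ : EuclideanSpace ℂ (Fin 3)))) x +
        realTrigPoly {(Pi.single 1 1 : Fin 3 → ℤ)} (fun _ => (EuclideanSpace.single 0 g : EuclideanSpace ℂ (Fin 3))) x := by
  rw [fderiv_mode, sum_kf_drift, convect_mode_eq_zero (by simp) (by simp) (by simp), add_zero,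
    laplacian_realTrigPoly_singleton, freqNormSq_kf, smul_smul, smul_realTrigPoly_apply, add_mode]
  refine congrFun (congrArg (realTrigPoly {(Pi.single 1 1 : Fin 3 → ℤ)}) (funext fun _ => ?_)) x
  rw [smul_single, smul_single, ← single_add]
  congr 1
  push_cast at h ⊢
  linear_combination h

/-- The detuned denominator `4π²ν + 2πi` has imaginary part `2π`. [folklore] -/
theorem den_im (ν : ℝ) : (((4 * Real.pi ^ 2 * ν : ℝ) : ℂ) + ((2 * Real.pi : ℝ) : ℂ) * Complex.I).im = 2 * Real.pi := by
  simp only [Complex.add_im, Complex.ofReal_im, Complex.mul_im, Complex.ofReal_re, Complex.I_re,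
    Complex.I_im, mul_zero, mul_one, zero_add, add_zero]

/-- The detuned denominator is non-zero. [folklore] -/
theorem den_ne_zero (ν : ℝ) : (((4 * Real.pi ^ 2 * ν : ℝ) : ℂ) + ((2 * Real.pi : ℝ) : ℂ) * Complex.I) ≠ 0 := by
  intro h
  have him := den_im ν
  rw [h, Complex.zero_im] at him
  linarith [Real.pi_pos]

/-- **Detuning bound** `|γ_ν| ≤ 1` for the response amplitude `γ_ν = -i/(4π²ν + 2πi)`: the drift replaces the
resonant laminar response `1/(4π²ν)` by `1/|4π²ν + 2πi| ≤ 1/(2π)`, uniformly in `ν`. [folklore] -/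
theorem norm_amp_le (ν : ℝ) : ‖-Complex.I / (((4 * Real.pi ^ 2 * ν : ℝ) : ℂ) + ((2 * Real.pi : ℝ) : ℂ) * Complex.I)‖ ≤ 1 := by
  have him := den_im ν
  have h1 : (1 : ℝ) ≤ ‖(((4 * Real.pi ^ 2 * ν : ℝ) : ℂ) + ((2 * Real.pi : ℝ) : ℂ) * Complex.I)‖ := by
    have h := Complex.abs_im_le_norm (((4 * Real.pi ^ 2 * ν : ℝ) : ℂ) + ((2 * Real.pi : ℝ) : ℂ) * Complex.I)
    rw [him, abs_of_pos Real.two_pi_pos] at h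
    linarith [Real.pi_gt_three]
  rw [norm_div, norm_neg, Complex.norm_I]
  exact div_le_one_of_le₀ h1 (norm_nonneg _)

/-- The response amplitude `γ_ν = -i/(4π²ν + 2πi)` satisfies the scalar balance `2πi γ = -4π²ν γ - i` of the
force `sin(2πx₁) e₀` (`g = -i`). [folklore] -/
theorem amp_balance (ν : ℝ) :
    (2 * Real.pi * Complex.I) * (-Complex.I / (((4 * Real.pi ^ 2 * ν : ℝ) : ℂ) + ((2 * Real.pi : ℝ) : ℂ) * Complex.I)) =
      ((ν * -(4 * Real.pi ^ 2) : ℝ) : ℂ) * (-Complex.I / (((4 * Real.pi ^ 2 * ν : ℝ) : ℂ) + ((2 * Real.pi : ℝ) : ℂ) * Complex.I)) + -Complex.I := by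
  have h : -Complex.I / (((4 * Real.pi ^ 2 * ν : ℝ) : ℂ) + ((2 * Real.pi : ℝ) : ℂ) * Complex.I) * (((4 * Real.pi ^ 2 * ν : ℝ) : ℂ) + ((2 * Real.pi : ℝ) : ℂ) * Complex.I) = -Complex.I :=
    div_mul_cancel₀ _ (den_ne_zero ν)
  set γ : ℂ := -Complex.I / (((4 * Real.pi ^ 2 * ν : ℝ) : ℂ) + ((2 * Real.pi : ℝ) : ℂ) * Complex.I)
  push_cast at h ⊢
  linear_combination h

/-! ## The constant drift is invisible to the space operators -/

/-- `D(c + g) = Dg` on the torus (Mathlib `fderiv_const_add` in the chart). [folklore] -/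
theorem torusFderiv_const_add (c : EuclideanSpace ℝ (Fin 3))
    (g : UnitAddTorus (Fin 3) → EuclideanSpace ℝ (Fin 3)) (x : UnitAddTorus (Fin 3)) :
    Torus.fderiv (fun z => c + g z) x = Torus.fderiv g x := by
  unfold Torus.fderiv
  rw [show liftAt (fun z => c + g z) x = fun v => c + liftAt g x v from rfl]
  exact fderiv_const_add c

/-- `Δ(c + g) = Δg` on the torus. [folklore] -/
theorem torusLaplacian_const_add (c : EuclideanSpace ℝ (Fin 3))
    (g : UnitAddTorus (Fin 3) → EuclideanSpace ℝ (Fin 3)) (x : UnitAddTorus (Fin 3)) :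
    Torus.laplacian (fun z => c + g z) x = Torus.laplacian g x := by
  unfold Torus.laplacian
  rw [show liftAt (fun z => c + g z) x = fun v => c + liftAt g x v from rfl, laplacian_const_add_fun]

/-- `div (c + g) = div g` on the torus (coordinatewise `deriv_const_add`). [folklore] -/
theorem torusDivergence_const_add (c : EuclideanSpace ℝ (Fin 3))
    (g : UnitAddTorus (Fin 3) → EuclideanSpace ℝ (Fin 3)) (x : UnitAddTorus (Fin 3)) :
    divergence (fun z => c + g z) x = divergence g x := by
  simp only [Torus.divergence, Torus.partialDeriv, Torus.lineDeriv, PiLp.add_apply, deriv_const_add]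

/-! ## Drifting laminar states are steady classical solutions with bounded energy -/

/-- **Steady classical solution.** If `2πi γ = -4π²ν γ + g`, then the drifting laminar state
`u = e₁ + Re (e_{e₁} • γ e₀)` (constant in time) with pressure `0` is a classical solution of NS_ν on `ℝ × T³`
driven by the steady force `Re (e_{e₁} • g e₀)`: the time derivative of a constant field vanishes,
`(u·∇)u = DW[V] + (W·∇)W`, `Δu = ΔW`, `div u = div W = 0`, `∇0 = 0`, and the rest is `balance`. [folklore] -/
theorem isClassical_drift {ν : ℝ} {γ g : ℂ}
    (h : (2 * Real.pi * Complex.I) * γ = ((ν * -(4 * Real.pi ^ 2) : ℝ) : ℂ) * γ + g) :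
    IsClassicalNSSolutionOn univ ν
      (fun _ : ℝ => realTrigPoly {(Pi.single 1 1 : Fin 3 → ℤ)} (fun _ => (EuclideanSpace.single 0 g : EuclideanSpace ℂ (Fin 3))))
      (fun (_ : ℝ) (x : UnitAddTorus (Fin 3)) => (EuclideanSpace.single 1 (1 : ℝ) : EuclideanSpace ℝ (Fin 3)) +
        realTrigPoly {(Pi.single 1 1 : Fin 3 → ℤ)} (fun _ => (EuclideanSpace.single 0 γ : EuclideanSpace ℂ (Fin 3))) x)
      (fun (_ : ℝ) (_ : UnitAddTorus (Fin 3)) => (0 : ℝ)) where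
  smooth_velocity := isSmoothSpaceTimeOn_const
    ((isSmooth_const (EuclideanSpace.single 1 (1 : ℝ) : EuclideanSpace ℝ (Fin 3))).add (isSmooth_realTrigPoly _ _)) univ
  smooth_pressure := isSmoothSpaceTimeOn_const (isSmooth_const (0 : ℝ)) univ
  momentum := fun t _ x => by
    -- abbreviations (definitional): the profile `W`, the force `F`, the drift `V`
    set W : UnitAddTorus (Fin 3) → EuclideanSpace ℝ (Fin 3) :=
      realTrigPoly {(Pi.single 1 1 : Fin 3 → ℤ)} (fun _ => (EuclideanSpace.single 0 γ : EuclideanSpace ℂ (Fin 3))) with hW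
    set F : UnitAddTorus (Fin 3) → EuclideanSpace ℝ (Fin 3) :=
      realTrigPoly {(Pi.single 1 1 : Fin 3 → ℤ)} (fun _ => (EuclideanSpace.single 0 g : EuclideanSpace ℂ (Fin 3))) with hF
    set V : EuclideanSpace ℝ (Fin 3) := (EuclideanSpace.single 1 (1 : ℝ) : EuclideanSpace ℝ (Fin 3)) with hV
    have hd : Torus.timeDerivWithin univ (fun (_ : ℝ) (x : UnitAddTorus (Fin 3)) => V + W x) t x = 0 := by
      simp [Torus.timeDerivWithin]
    have hg : Torus.gradient (fun _ : UnitAddTorus (Fin 3) => (0 : ℝ)) x = 0 := by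
      rw [Torus.gradient, (rfl : liftAt (fun _ : UnitAddTorus (Fin 3) => (0 : ℝ)) x = fun _ => 0)]
      exact gradient_fun_const 0 0
    show Torus.timeDerivWithin univ (fun (_ : ℝ) (x : UnitAddTorus (Fin 3)) => V + W x) t x +
        Torus.convect (fun x => V + W x) (fun x => V + W x) x =
      ν • Torus.laplacian (fun x => V + W x) x - Torus.gradient (fun _ : UnitAddTorus (Fin 3) => (0 : ℝ)) x + F x
    rw [hd, zero_add, hg, sub_zero, Torus.convect, torusFderiv_const_add, map_add,
      torusLaplacian_const_add, hW, hF, hV]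
    exact balance h x
  divFree := fun _ _ x => by
    rw [torusDivergence_const_add]
    exact isDivFree_mode γ x

/-- **Uniform energy bound**: if `|γ| ≤ 1` then `∫ ‖e₁ + Re (e_{e₁} • γ e₀)‖² ≤ 4` (pointwise
`‖e₁‖ + ‖Re (e_{e₁} • γ e₀)‖ ≤ 1 + |γ| ≤ 2`; the torus has volume one). [folklore] -/
theorem energy_le {γ : ℂ} (hγ : ‖γ‖ ≤ 1) :
    ∫ x, ‖(EuclideanSpace.single 1 (1 : ℝ) : EuclideanSpace ℝ (Fin 3)) +
      realTrigPoly {(Pi.single 1 1 : Fin 3 → ℤ)} (fun _ => (EuclideanSpace.single 0 γ : EuclideanSpace ℂ (Fin 3))) x‖ ^ 2 ≤ 4 := by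
  set W : UnitAddTorus (Fin 3) → EuclideanSpace ℝ (Fin 3) :=
    realTrigPoly {(Pi.single 1 1 : Fin 3 → ℤ)} (fun _ => (EuclideanSpace.single 0 γ : EuclideanSpace ℂ (Fin 3))) with hW
  set V : EuclideanSpace ℝ (Fin 3) := (EuclideanSpace.single 1 (1 : ℝ) : EuclideanSpace ℝ (Fin 3)) with hV
  have hpt : ∀ x, ‖V + W x‖ ^ 2 ≤ 4 := by
    intro x
    have hV1 : ‖V‖ = 1 := by simp [hV]
    have hW1 : ‖W x‖ ≤ 1 := by
      refine (norm_realTrigPoly_singleton_le _ _ x).trans ?_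
      have hn : ‖(EuclideanSpace.single 0 γ : EuclideanSpace ℂ (Fin 3))‖ = ‖γ‖ := by simp
      rw [hn]
      exact hγ
    have h2 : ‖V + W x‖ ≤ 2 := by
      refine (norm_add_le _ _).trans ?_
      rw [hV1]
      linarith
    nlinarith [norm_nonneg (V + W x)]
  have hcont : Continuous fun x => V + W x := continuous_const.add (continuous_realTrigPoly _ _)
  have hint : Integrable (fun x => ‖V + W x‖ ^ 2) volume := ((hcont.norm).pow 2).integrable_unitAddTorus
  calc ∫ x, ‖V + W x‖ ^ 2 ≤ ∫ _ : UnitAddTorus (Fin 3), (4 : ℝ) :=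
        integral_mono hint (integrable_const _) fun x => hpt x
    _ = 4 := by simp

/-- The viscosities `ν_j = 1/(j+1)` are positive. [folklore] -/
theorem nu_pos (j : ℕ) : 0 < 1 / ((j : ℝ) + 1) := by positivity

end CoherentStatesSteadyDrift

open CoherentStatesSteadyDrift Literature.Analysis.FunctionSpaces Literature.Analysis.FunctionSpaces.Torus in
/-- **`SteadyBoundedBranch` holds (closes stmt-AnomalousDissipation-0221).** Witness: the steady
force `f = sin(2πx₁) e₀`, viscosities `ν_j = 1/(j+1)`, the drifting laminar states
`u_j = e₁ + Re (e_{e₁} • γ_{ν_j} e₀)`, `γ_ν = -i/(4π²ν + 2πi)`, pressures `0`; energies `≤ 4`.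
The statement is true as typed because `Torus.IsClassicalNSSolutionOn` does not fix the velocity
mean (Galilean drift); see the module docstring. [folklore] -/
theorem SteadyBoundedBranch_proof :
    Summit.AnomalousDissipation.AnomalousDissipation.Theses.CoherentStates.SteadyBoundedBranch := by
  unfold Summit.AnomalousDissipation.AnomalousDissipation.Theses.CoherentStates.SteadyBoundedBranch
  exact ⟨realTrigPoly {(Pi.single 1 1 : Fin 3 → ℤ)} (fun _ => (EuclideanSpace.single 0 (-Complex.I) : EuclideanSpace ℂ (Fin 3))),
    isSmooth_realTrigPoly _ _, isDivFree_mode _, hasZeroMean_mode0 _,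
    mode_ne_zero (neg_ne_zero.2 Complex.I_ne_zero),
    fun j => 1 / ((j : ℝ) + 1), _, fun _ _ => 0, nu_pos, tendsto_one_div_add_atTop_nhds_zero_nat,
    fun j => isClassical_drift (amp_balance (1 / ((j : ℝ) + 1))), 4,
    fun j => energy_le (norm_amp_le (1 / ((j : ℝ) + 1)))⟩

end Summit.AnomalousDissipation.AnomalousDissipation.Theorems

end
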